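import Mathlib
import Summits.AtomisticToContinuum.HydrodynamicLimit.Theorems.ImplosionDichotomyDenseExcursionPackingAnalyticDefsB

/-!
# Uniqueness of the smooth solution of the Euler equation `x q′ + a q = 0`, `a > 0` (the `T_ν` bound is A PRIORI)
# (crux `DenseExcursion`, stmt-AtomisticToContinuum-12586, line `sonic-cavity-renewal` v7, stub `stub_analyticPackingImplosion`)

Helper file (`--supports stmt-AtomisticToContinuum-12586`, line lead a2, wave-3 worker D, task (4) `sonicWindow_analytic_bound`,
second brick). Companion of `eulerResolvent_smooth_bound` (`…PackingAnalyticSonicEulerResolvent`): there the smooth solution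
`Y = T_a h` of `x Y′ + a Y = h` was CONSTRUCTED with the no-loss bounds `|Y⁽ʲ⁾| ≤ sup|h⁽ʲ⁾|/(a + j)`. In the packing hierarchy
the order-`k` solution is GIVEN (by `PackingResolvent`), so the bounds are needed A PRIORI; this follows from uniqueness:

* `eulerResolvent_unique` (REGISTERED helper): for `a > 0`, a function differentiable on `(−ρ, ρ)` with `x q′ + a q = 0`
  there vanishes identically (`(xᵃq)′ = 0` on `(0, ρ)`, `xᵃ q → 0` at `0⁺`; mirror image on `(−ρ, 0)`; `q(0) = 0` from the
  equation at `0`) — the homogeneous solutions `|x|^{−a}` are singular: for `ν(kμ) < 0` the smooth branch is unique;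
* `eulerResolvent_eq`: hence two differentiable solutions of `x p′ + a p = h` on `(−ρ, ρ)` coincide.

Elementary real analysis over Mathlib. NOT here: the window estimate itself.
-/

noncomputable section

open Set Filter
open scoped Topology

namespace Summit.AtomisticToContinuum.HydrodynamicLimit.Theorems.PackingAnalyticImplosion

/-- The positive half: `x q′ + a q = 0` on `(0, ρ)` with `q` differentiable there and continuous at `0` with `q 0 = 0`...
in fact only boundedness near `0⁺` is used, supplied here by continuity within `[0, ρ)`. [folklore] -/
theorem euler_homogeneous_pos {a ρ : ℝ} {q : ℝ → ℝ} (ha : 0 < a) (hq : DifferentiableOn ℝ q (Ioo 0 ρ))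
    (hq0 : ContinuousWithinAt q (Ici 0) 0) (heq : ∀ x ∈ Ioo 0 ρ, x * deriv q x + a * q x = 0) :
    ∀ x ∈ Ioo 0 ρ, q x = 0 := by
  intro x₀ hx₀
  -- `φ = xᵃ q` has zero derivative on `(0, ρ)`, hence is constant there
  set φ : ℝ → ℝ := fun x => x ^ a * q x with hφ
  have hφd : ∀ x ∈ Ioo 0 ρ, HasDerivAt φ 0 x := by
    intro x hx
    have h1 : HasDerivAt (fun x : ℝ => x ^ a) (a * x ^ (a - 1)) x := Real.hasDerivAt_rpow_const (Or.inl hx.1.ne')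
    have h2 : HasDerivAt q (deriv q x) x := ((hq x hx).differentiableAt (isOpen_Ioo.mem_nhds hx)).hasDerivAt
    refine (h1.mul h2).congr_deriv ?_
    have hxa : x ^ a = x ^ (a - 1) * x := by
      rw [← Real.rpow_add_one hx.1.ne']; ring_nf
    rw [hxa]
    have := heq x hx
    linear_combination x ^ (a - 1) * this
  have hconst : ∀ x ∈ Ioo 0 ρ, φ x = φ x₀ := by
    intro x hx
    have hdiff : DifferentiableOn ℝ φ (Ioo 0 ρ) := fun y hy => (hφd y hy).differentiableAt.differentiableWithinAt
    refine (convex_Ioo 0 ρ).is_const_of_fderivWithin_eq_zero hdiff (fun y hy => ?_) hx hx₀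
    rw [fderivWithin_of_isOpen isOpen_Ioo hy, (hφd y hy).hasFDerivAt.fderiv]
    ext; simp
  -- `φ → 0` at `0⁺`
  have hlim : Tendsto φ (𝓝[>] 0) (𝓝 0) := by
    have h1 : Tendsto (fun x : ℝ => x ^ a) (𝓝[>] 0) (𝓝 0) := by
      have := (Real.continuousAt_rpow_const 0 a (Or.inr ha.le)).tendsto
      rw [Real.zero_rpow ha.ne'] at this
      exact this.mono_left nhdsWithin_le_nhds
    have h2 : Tendsto q (𝓝[>] 0) (𝓝 (q 0)) := hq0.tendsto.mono_left (nhdsWithin_mono _ Ioi_subset_Ici_self)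
    have h := h1.mul h2
    rw [zero_mul] at h
    exact h
  -- the constant is `0`
  have hev : φ =ᶠ[𝓝[>] 0] fun _ => φ x₀ := by
    have hρ' : (0:ℝ) < ρ := hx₀.1.trans hx₀.2
    exact Filter.mem_of_superset (Ioo_mem_nhdsGT hρ') fun x hx => hconst x hx
  have hφ0 : φ x₀ = 0 := by
    have h := hlim.congr' hev
    exact tendsto_nhds_unique tendsto_const_nhds h ▸ rfl
  have hxa : x₀ ^ a ≠ 0 := (Real.rpow_pos_of_pos hx₀.1 a).ne'
  have : x₀ ^ a * q x₀ = 0 := hφ0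
  rcases mul_eq_zero.mp this with h | h
  · exact absurd h hxa
  · exact h

/-- **UNIQUENESS OF THE SMOOTH BRANCH OF THE EULER EQUATION** (registered helper `eulerResolvent_unique` of
`stub_analyticPackingImplosion`): for `a > 0`, a function differentiable on `(−ρ, ρ)` with `x q′ + a q = 0` there is
identically `0` there. [folklore] -/
theorem eulerResolvent_unique : ∀ (a ρ : ℝ) (q : ℝ → ℝ), 0 < a → 0 < ρ → DifferentiableOn ℝ q (Set.Ioo (-ρ) ρ) → (∀ x ∈ Set.Ioo (-ρ) ρ, x * deriv q x + a * q x = 0) → ∀ x ∈ Set.Ioo (-ρ) ρ, q x = 0 := by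
  intro a ρ q ha hρ hq heq x hx
  have h0U : (0 : ℝ) ∈ Ioo (-ρ) ρ := ⟨by linarith, hρ⟩
  have hqc0 : ContinuousAt q 0 := ((hq 0 h0U).differentiableAt (isOpen_Ioo.mem_nhds h0U)).continuousAt
  rcases lt_trichotomy x 0 with hneg | rfl | hpos
  · -- mirror: `q̃ x = q (−x)` solves the same equation on `(0, ρ)`
    have hsub : ∀ y ∈ Ioo 0 ρ, -y ∈ Ioo (-ρ) ρ := fun y hy => ⟨by linarith [hy.2], by linarith [hy.1]⟩
    have hq' : DifferentiableOn ℝ (fun y => q (-y)) (Ioo 0 ρ) := by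
      intro y hy
      have hd : DifferentiableAt ℝ q (-y) := (hq _ (hsub y hy)).differentiableAt (isOpen_Ioo.mem_nhds (hsub y hy))
      exact (hd.comp y differentiableAt_id.neg).differentiableWithinAt
    have heq' : ∀ y ∈ Ioo 0 ρ, y * deriv (fun y => q (-y)) y + a * (fun y => q (-y)) y = 0 := by
      intro y hy
      rw [deriv_comp_neg q y]
      have := heq (-y) (hsub y hy)
      simp only
      linarith
    have hc' : ContinuousWithinAt (fun y => q (-y)) (Ici 0) 0 := by
      have : ContinuousAt (fun y => q (-y)) 0 := by
        have h := hqc0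
        rw [show (0:ℝ) = -0 by simp] at h
        exact h.comp continuous_neg.continuousAt
      exact this.continuousWithinAt
    have h := euler_homogeneous_pos ha hq' hc' heq' (-x) ⟨by linarith, by linarith [hx.1]⟩
    simpa using h
  · have := heq 0 h0U
    rw [zero_mul, zero_add] at this
    rcases mul_eq_zero.mp this with h | h
    · exact absurd h ha.ne'
    · exact h
  · exact euler_homogeneous_pos ha (hq.mono fun y hy => ⟨by linarith [hy.1], hy.2⟩) hqc0.continuousWithinAt
      (fun y hy => heq y ⟨by linarith [hy.1], hy.2⟩) x ⟨hpos, hx.2⟩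

/-- Two differentiable solutions of `x p′ + a p = h` on `(−ρ, ρ)`, `a > 0`, coincide there. [folklore] -/
theorem eulerResolvent_eq {a ρ : ℝ} {p₁ p₂ h : ℝ → ℝ} (ha : 0 < a) (hρ : 0 < ρ)
    (hp₁ : DifferentiableOn ℝ p₁ (Ioo (-ρ) ρ)) (hp₂ : DifferentiableOn ℝ p₂ (Ioo (-ρ) ρ))
    (h₁ : ∀ x ∈ Ioo (-ρ) ρ, x * deriv p₁ x + a * p₁ x = h x) (h₂ : ∀ x ∈ Ioo (-ρ) ρ, x * deriv p₂ x + a * p₂ x = h x) :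
    ∀ x ∈ Ioo (-ρ) ρ, p₁ x = p₂ x := by
  intro x hx
  have hd : DifferentiableOn ℝ (fun y => p₁ y - p₂ y) (Ioo (-ρ) ρ) := hp₁.sub hp₂
  have heq : ∀ y ∈ Ioo (-ρ) ρ, y * deriv (fun y => p₁ y - p₂ y) y + a * (fun y => p₁ y - p₂ y) y = 0 := by
    intro y hy
    have hn : Ioo (-ρ) ρ ∈ 𝓝 y := isOpen_Ioo.mem_nhds hy
    have d1 := (hp₁ y hy).differentiableAt hn
    have d2 := (hp₂ y hy).differentiableAt hn
    rw [deriv_fun_sub d1 d2]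
    have e1 := h₁ y hy
    have e2 := h₂ y hy
    simp only
    linarith
  have := eulerResolvent_unique a ρ (fun y => p₁ y - p₂ y) ha hρ hd heq x hx
  linarith

end Summit.AtomisticToContinuum.HydrodynamicLimit.Theorems.PackingAnalyticImplosion

end
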